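import Mathlib.Analysis.Fourier.FiniteAbelian.PontryaginDuality
import Mathlib.Analysis.SpecialFunctions.Complex.CircleAddChar
import Mathlib.Data.Matrix.Mul
import HarnessLib

/-!
# Crux `Capture` (stmt-PneNP-2659), line `csp-spine-meet-to-join` — pseudo-solutions over the ring `ℤ/m`
# (`zmod_pseudo_solution`, first brick of regime R-a "Theorem A over `ℤ/m`" of the residual dossier)

Unit-normalised duality over `ZMod m`: if a subgroup `S` of augmented relations `(w, b) ∈ (Idx → ℤ/m) × ℤ/m`
contains no `(0, t)` with `t ≠ 0`, then some pseudo-assignment `Y` satisfies every relation of `S`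
(`Σ wᵢ Yᵢ = b`). Over a field this is linear duality; over `ℤ/m` it is `N = N^⊥⊥` (complex characters of
`(ℤ/m)^k` are dot products) plus the fact that a proper subgroup of `ℤ/m` is killed by a nonzero element.
Mathlib only (the corresponding lemmas of `ConvexRankGatesCaptureCyclicFredholm` are private). Continuation lead c1,
2026-08-16. [folklore]
-/

namespace Summit.PneNP.PneNP.Cruxes.Capture.CspSpineMeetToJoin

set_option linter.dupNamespace false -- `Summit.PneNP.PneNP.…`: summit = sub-problem (D-0017)

open Matrix

/-- **Pseudo-solutions over `ℤ/m`** (registered sub-goal `zmod_pseudo_solution`): a subgroup of augmented affine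
relations over `ZMod m` with no `(0, t)`, `t ≠ 0`, has a common pseudo-solution. [folklore] -/
theorem zmod_pseudo_solution : ∀ (m : ℕ) [NeZero m] (Idx : Type) [Fintype Idx] [DecidableEq Idx]
    (S : AddSubgroup ((Idx → ZMod m) × ZMod m)),
    (∀ t : ZMod m, ((0 : Idx → ZMod m), t) ∈ S → t = 0) →
    ∃ Y : Idx → ZMod m, ∀ wb ∈ S, ∑ i, wb.1 i * Y i = wb.2 := by
  intro m _ Idx _ _ S hS
  -- (1) complex characters of `(Idx → ℤ/m) × ℤ/m` are `e(u ⬝ w + u₀ b)`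
  have hchar : ∀ φ : AddChar ((Idx → ZMod m) × ZMod m) ℂ, ∃ (u : Idx → ZMod m) (u₀ : ZMod m),
      ∀ w b, φ (w, b) = ZMod.stdAddChar (u ⬝ᵥ w + u₀ * b) := by
    intro φ
    have hc : ∀ i, ∃ c : ZMod m, ∀ t, φ (Pi.single i t, 0) = ZMod.stdAddChar (c * t) := fun i => by
      obtain ⟨c, hc⟩ := (AddChar.zmodAddEquiv (n := m)).surjective (φ.compAddMonoidHom
        ((AddMonoidHom.inl (Idx → ZMod m) (ZMod m)).comp (AddMonoidHom.single (fun _ : Idx => ZMod m) i)))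
      exact ⟨c, fun t => (DFunLike.congr_fun hc t).symm⟩
    choose u hu using hc
    obtain ⟨u₀, hu₀⟩ : ∃ c : ZMod m, ∀ t, φ (0, t) = ZMod.stdAddChar (c * t) := by
      obtain ⟨c, hc⟩ := (AddChar.zmodAddEquiv (n := m)).surjective
        (φ.compAddMonoidHom (AddMonoidHom.inr (Idx → ZMod m) (ZMod m)))
      exact ⟨c, fun t => (DFunLike.congr_fun hc t).symm⟩
    refine ⟨u, u₀, fun w b => ?_⟩
    have hw : φ (w, 0) = ZMod.stdAddChar (u ⬝ᵥ w) := by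
      refine Pi.single_induction (fun w => φ (w, 0) = ZMod.stdAddChar (u ⬝ᵥ w)) w ?_ ?_ ?_
      · rw [dotProduct_zero, AddChar.map_zero_eq_one]; exact AddChar.map_zero_eq_one φ
      · intro f g hf hg
        have : ((f + g, 0) : (Idx → ZMod m) × ZMod m) = (f, 0) + (g, 0) := by simp
        rw [this, AddChar.map_add_eq_mul, hf, hg, dotProduct_add, AddChar.map_add_eq_mul]
      · intro i t
        rw [hu, dotProduct_single]
    have : ((w, b) : (Idx → ZMod m) × ZMod m) = (w, 0) + (0, b) := by simp
    rw [this, AddChar.map_add_eq_mul, hw, hu₀, AddChar.map_add_eq_mul]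
  -- (2) `S = S^⊥⊥`: a point outside `S` is detected by an annihilator of `S`
  have hsep : ∀ x : (Idx → ZMod m) × ZMod m, x ∉ S → ∃ (u : Idx → ZMod m) (u₀ : ZMod m),
      (∀ wb ∈ S, u ⬝ᵥ wb.1 + u₀ * wb.2 = 0) ∧ u ⬝ᵥ x.1 + u₀ * x.2 ≠ 0 := by
    intro x hx
    have hx' : (x : ((Idx → ZMod m) × ZMod m) ⧸ S) ≠ 0 := mt (QuotientAddGroup.eq_zero_iff x).1 hx
    obtain ⟨ψ, hψ⟩ := AddChar.exists_apply_ne_zero.2 hx'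
    obtain ⟨u, u₀, hu⟩ := hchar (ψ.compAddMonoidHom (QuotientAddGroup.mk' S))
    refine ⟨u, u₀, fun wb hwb => ZMod.injective_stdAddChar ?_, fun h0 => hψ ?_⟩
    · rw [← hu, AddChar.map_zero_eq_one, AddChar.compAddMonoidHom_apply, QuotientAddGroup.mk'_apply,
        Prod.mk.eta, (QuotientAddGroup.eq_zero_iff wb).2 hwb, AddChar.map_zero_eq_one]
    · rw [← Prod.mk.eta (p := x), ← QuotientAddGroup.mk'_apply, ← AddChar.compAddMonoidHom_apply, hu, h0,
        AddChar.map_zero_eq_one]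
  -- (3) the annihilator of `S` and its subgroup `J` of last coordinates
  let A : AddSubgroup ((Idx → ZMod m) × ZMod m) :=
    { carrier := {p | ∀ wb ∈ S, p.1 ⬝ᵥ wb.1 + p.2 * wb.2 = 0}
      zero_mem' := fun wb _ => by simp
      add_mem' := fun {p q} hp hq wb hwb => by
        simp only [Prod.fst_add, Prod.snd_add, add_dotProduct, add_mul]
        linear_combination hp wb hwb + hq wb hwb
      neg_mem' := fun {p} hp wb hwb => by
        simp only [Prod.fst_neg, Prod.snd_neg, neg_dotProduct, neg_mul]
        linear_combination -(hp wb hwb) }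
  let J : AddSubgroup (ZMod m) := A.map (AddMonoidHom.snd (Idx → ZMod m) (ZMod m))
  by_cases hJ : J = ⊤
  · -- `1 ∈ J`: an annihilator `(u, 1)`, and `Y := -u` is a pseudo-solution
    have h1 : (1 : ZMod m) ∈ J := hJ ▸ AddSubgroup.mem_top 1
    obtain ⟨⟨u, u₀⟩, hA, hu₀⟩ := AddSubgroup.mem_map.1 h1
    simp only [AddMonoidHom.coe_snd] at hu₀
    subst hu₀
    refine ⟨-u, fun wb hwb => ?_⟩
    have := hA wb hwb
    simp only [one_mul] at this
    simp only [dotProduct] at this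
    calc ∑ i, wb.1 i * (-u) i = -(∑ i, u i * wb.1 i) := by
          rw [← Finset.sum_neg_distrib]; exact Finset.sum_congr rfl fun i _ => by simp [mul_comm]
      _ = wb.2 := by linear_combination -this
  · -- `J` proper: some `c ≠ 0` kills `J`; then `(0, c) ∈ S^⊥⊥ = S`, contradicting the hypothesis
    obtain ⟨c, hc, hcJ⟩ : ∃ c : ZMod m, c ≠ 0 ∧ ∀ j ∈ J, c * j = 0 := by
      refine ⟨Nat.card J, fun h => hJ ?_, fun j hj => ?_⟩
      · rw [ZMod.natCast_eq_zero_iff] at h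
        refine AddSubgroup.eq_top_of_card_eq J ?_
        rw [Nat.card_zmod]
        exact Nat.dvd_antisymm (by simpa only [Nat.card_zmod] using J.card_addSubgroup_dvd_card) h
      · rw [← nsmul_eq_mul]
        exact congrArg Subtype.val (card_nsmul_eq_zero' (x := (⟨j, hj⟩ : J)))
    exfalso
    refine hc (hS c ?_)
    by_contra hmem
    obtain ⟨u, u₀, hu, hne⟩ := hsep _ hmem
    have hj : u₀ ∈ J := AddSubgroup.mem_map.2 ⟨(u, u₀), hu, rfl⟩
    apply hne
    simp only [dotProduct_zero, zero_add]
    rw [mul_comm]; exact hcJ u₀ hj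

/-- **Affine separation over `ℤ/m`** (registered sub-goal `zmod_affine_separation`; the `ℤ/m` analogue of the third
part of `span_prep_lemmas`): a point outside a nonempty coset `A'` of a subgroup of `(ι → ℤ/m)` (a set closed under
`u - u' + u''`) is cut off by an affine functional vanishing on `A'` — `N = N^⊥⊥` over `ℤ/m`. [folklore] -/
theorem zmod_affine_separation : ∀ (m : ℕ) [NeZero m] (ι : Type) [Fintype ι] [DecidableEq ι]
    (A' : Set (ι → ZMod m)), A'.Nonempty → (∀ u ∈ A', ∀ u' ∈ A', ∀ u'' ∈ A', u - u' + u'' ∈ A') →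
    ∀ a ∉ A', ∃ e : ZMod m × (ι → ZMod m), (∀ u ∈ A', e.1 + ∑ i, e.2 i * u i = 0) ∧ e.1 + ∑ i, e.2 i * a i ≠ 0 := by
  intro m _ ι _ _ A' ⟨u₀, hu₀⟩ h3 a ha
  -- characters of `ι → ℤ/m` are dot products
  have hchar : ∀ φ : AddChar (ι → ZMod m) ℂ, ∃ u : ι → ZMod m, ∀ w, φ w = ZMod.stdAddChar (u ⬝ᵥ w) := by
    intro φ
    have hc : ∀ i, ∃ c : ZMod m, ∀ t, φ (Pi.single i t) = ZMod.stdAddChar (c * t) := fun i => by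
      obtain ⟨c, hc⟩ := (AddChar.zmodAddEquiv (n := m)).surjective
        (φ.compAddMonoidHom (AddMonoidHom.single (fun _ : ι => ZMod m) i))
      exact ⟨c, fun t => (DFunLike.congr_fun hc t).symm⟩
    choose u hu using hc
    refine ⟨u, fun w => Pi.single_induction (fun w => φ w = ZMod.stdAddChar (u ⬝ᵥ w)) w ?_ ?_ ?_⟩
    · rw [dotProduct_zero, AddChar.map_zero_eq_one, AddChar.map_zero_eq_one]
    · intro f g hf hg
      rw [AddChar.map_add_eq_mul, hf, hg, dotProduct_add, AddChar.map_add_eq_mul]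
    · intro i t
      rw [hu, dotProduct_single]
  -- the direction subgroup `W` of `A'`
  let W : AddSubgroup (ι → ZMod m) :=
    { carrier := {d | u₀ + d ∈ A'}
      zero_mem' := by simpa using hu₀
      add_mem' := fun {d d'} hd hd' => by
        have := h3 _ hd _ hu₀ _ hd'
        have e : u₀ + d - u₀ + (u₀ + d') = u₀ + (d + d') := by abel
        show u₀ + (d + d') ∈ A'
        rwa [e] at this
      neg_mem' := fun {d} hd => by
        have := h3 _ hu₀ _ hd _ hu₀
        have e : u₀ - (u₀ + d) + u₀ = u₀ + -d := by abel
        show u₀ + -d ∈ A'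
        rwa [e] at this }
  have hW : a - u₀ ∉ W := fun h => ha (by simpa using (show u₀ + (a - u₀) ∈ A' from h))
  -- separate `a - u₀` from `W` by a dot-product character
  have hx' : ((a - u₀ : ι → ZMod m) : (ι → ZMod m) ⧸ W) ≠ 0 := mt (QuotientAddGroup.eq_zero_iff _).1 hW
  obtain ⟨ψ, hψ⟩ := AddChar.exists_apply_ne_zero.2 hx'
  obtain ⟨u, hu⟩ := hchar (ψ.compAddMonoidHom (QuotientAddGroup.mk' W))
  have hWu : ∀ d ∈ W, u ⬝ᵥ d = 0 := fun d hd => ZMod.injective_stdAddChar (by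
    rw [← hu, AddChar.map_zero_eq_one, AddChar.compAddMonoidHom_apply, QuotientAddGroup.mk'_apply,
      (QuotientAddGroup.eq_zero_iff d).2 hd, AddChar.map_zero_eq_one])
  have hau : u ⬝ᵥ (a - u₀) ≠ 0 := fun h0 => hψ (by
    rw [← QuotientAddGroup.mk'_apply, ← AddChar.compAddMonoidHom_apply, hu, h0, AddChar.map_zero_eq_one])
  refine ⟨(-(u ⬝ᵥ u₀), u), fun x hx => ?_, ?_⟩
  · have hd : x - u₀ ∈ W := by show u₀ + (x - u₀) ∈ A'; simpa using hx
    have := hWu _ hd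
    rw [dotProduct_sub] at this
    show -(u ⬝ᵥ u₀) + ∑ i, u i * x i = 0
    change -(u ⬝ᵥ u₀) + u ⬝ᵥ x = 0
    linear_combination this
  · show -(u ⬝ᵥ u₀) + ∑ i, u i * a i ≠ 0
    change -(u ⬝ᵥ u₀) + u ⬝ᵥ a ≠ 0
    intro h0; apply hau
    rw [dotProduct_sub]; linear_combination h0

end Summit.PneNP.PneNP.Cruxes.Capture.CspSpineMeetToJoin
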